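import Mathlib.Algebra.MvPolynomial.Monad
import Summits.QuantumAdvantage.QuantumAdvantage.Theorems.RandomOracleGaugeOneBlockDecouplingStubComparisonMoments

/-!
# Crux `DecoupledCoreAA` (stmt-QuantumAdvantage-17872, route RandomOracleGauge), line `l1-family` — stub `stub_derivativeFamily`

Bookkeeping for a ONE-BLOCK-DECOUPLED polynomial `q ∈ ℝ[Fin (N+N)]`,
`q(y,z) = c₀ + Σ_i (±1)^{y_i} g_i(z)` on the glued cube (O'Donnell–Zhao–Wright, arXiv:1512.01603, eqn. (2.1)),
bounded in `[0,1]` and of total degree `≤ d`: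

* `Σ_i |g_i(z)| ≤ 1/2` for every `z` (align the signs `y` with the `g_i(z)`: `q(y⁺,z) − q(y⁻,z) = 2 Σ_i |g_i(z)| ≤ 1`);
* `Inf_{y_i}[q] = 4 E_z[g_i²]` (flipping `y_i` changes `q` by `±2 g_i(z)`);
* `Inf_{z_j}[q] = Σ_i E_z[(g_i − g_i^{⊕j})²]` (orthogonality of the `(±1)^{y_i}` in `y`);
* `Var q = Σ_i E_z[g_i²]` (`E q = c₀`, same orthogonality);
* each `g_i` is the cube function of a polynomial of total degree `≤ d` in the `z`-variables:
  `g_i = (q|_{y = e_i} − q|_{y = 0})/2`, a substitution of constants for the `y`-block (`MvPolynomial.bind₁`), which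
  does not raise the total degree (`totalDegree_bind₁_le_of_le_one`).

**`stub_derivativeFamily`** — the registered stub of `Cruxes/AAConj/Lines/l1_family.lean`, BY NAME. After this file the
only open stub of the whole split `AAConj ⟸ DecoupledCoreAA ∧ OneBlockDecoupling ∧ VarianceAmplification` is the
analytic dichotomy `stub_l1Family`. Elementary; no named facts, no new definitions (glued-cube lemmas reused from
`…OneBlockDecouplingStubComparisonMoments`).
-/

-- D-0017: single-conjunct summit ⇒ the duplicate `QuantumAdvantage.QuantumAdvantage` is mandated.
set_option linter.dupNamespace false

noncomputable section

open Finset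
open Literature.Computability.QuantumComplexity
open Literature.Probability.RandomGraphs.LowDegree (sgn)
open Summit.QuantumAdvantage.QuantumAdvantage.Cruxes.OneBlockDecoupling.OdonnellZhao.StubComparison
  (sum_cube_append flipBit_castAdd_append flipBit_natAdd_append sum_sq_sum_sgn sum_sgn_eq_zero)

namespace Summit.QuantumAdvantage.QuantumAdvantage.Cruxes.DecoupledCoreAA.L1Family

namespace StubDerivativeFamily

variable {N : ℕ}

/-! ### The route's `±1` signs `(±1)^{y_i} = if y i then 1 else −1 = −sgn (y i)` -/

/-- `(±1)^{b} = −sgn b`. [folklore] -/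
theorem ite_eq_neg_sgn (b : Bool) : (if b then (1 : ℝ) else -1) = -sgn b := by
  cases b <;> simp [sgn]

/-- Orthogonality in the route's spelling: `Σ_y (Σ_i (±1)^{y_i} a_i)² = 2^N Σ_i a_i²`. [cite: ODonnell2014, §1.4] -/
theorem sum_sq_sum_ite (a : Fin N → ℝ) :
    ∑ y : Fin N → Bool, (∑ i, (if y i then (1 : ℝ) else -1) * a i) ^ 2 = 2 ^ N * ∑ i, a i ^ 2 := by
  have h : ∀ y : Fin N → Bool, (∑ i, (if y i then (1 : ℝ) else -1) * a i) ^ 2 = (∑ i, sgn (y i) * a i) ^ 2 := by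
    intro y
    simp_rw [ite_eq_neg_sgn, neg_mul, Finset.sum_neg_distrib, neg_sq]
  simp_rw [h]
  exact sum_sq_sum_sgn a

/-- `Σ_y (±1)^{y_i} = 0`. [cite: ODonnell2014, §1.4] -/
theorem sum_ite_sign_eq_zero (i : Fin N) : ∑ y : Fin N → Bool, (if y i then (1 : ℝ) else -1) = 0 := by
  simp_rw [ite_eq_neg_sgn, Finset.sum_neg_distrib, sum_sgn_eq_zero i, neg_zero]

/-! ### Substituting constants for one block does not raise the total degree -/

/-- If every substituted polynomial has total degree `≤ 1`, `bind₁` does not raise the total degree. [folklore] -/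
theorem totalDegree_bind₁_le_of_le_one {σ τ : Type*} (h : σ → MvPolynomial τ ℝ)
    (hh : ∀ i, (h i).totalDegree ≤ 1) (q : MvPolynomial σ ℝ) :
    (MvPolynomial.bind₁ h q).totalDegree ≤ q.totalDegree := by
  classical
  conv_lhs => rw [q.as_sum]
  rw [map_sum]
  refine (MvPolynomial.totalDegree_finsetSum _ _).trans (Finset.sup_le fun m hm => ?_)
  rw [MvPolynomial.bind₁_monomial]
  refine (MvPolynomial.totalDegree_mul _ _).trans ?_
  rw [MvPolynomial.totalDegree_C, zero_add]
  refine (MvPolynomial.totalDegree_finsetProd _ _).trans ?_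
  refine (Finset.sum_le_sum fun i _ => (MvPolynomial.totalDegree_pow _ _).trans
    (Nat.mul_le_mul_left _ (hh i))).trans ?_
  simp only [mul_one]
  exact MvPolynomial.le_totalDegree hm

/-! ### The decoupled bookkeeping -/

variable {q : MvPolynomial (Fin (N + N)) ℝ} {c₀ : ℝ} {g : Fin N → (Fin N → Bool) → ℝ}
  (hg : ∀ (y z : Fin N → Bool), evalBool q (Fin.append y z) = c₀ + ∑ i, (if y i then (1 : ℝ) else -1) * g i z)
include hg

/-- Sign alignment: `Σ_i |g_i(z)| ≤ 1/2`. [cite: ODonnellZhao2016, eqn. (2.1)] -/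
theorem sum_abs_le_half (hb : ∀ x, 0 ≤ evalBool q x ∧ evalBool q x ≤ 1) (z : Fin N → Bool) :
    ∑ i, |g i z| ≤ 1 / 2 := by
  set yp : Fin N → Bool := fun i => decide (0 ≤ g i z) with hyp
  have hs : ∀ i, (if yp i then (1 : ℝ) else -1) * g i z = |g i z| := by
    intro i
    by_cases h : 0 ≤ g i z
    · simp [hyp, h, abs_of_nonneg h]
    · simp [hyp, h, abs_of_neg (lt_of_not_ge h)]
  have hs' : ∀ i, (if (fun i => !yp i) i then (1 : ℝ) else -1) * g i z = -|g i z| := by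
    intro i
    have := hs i
    cases hy : yp i <;> simp [hy] at this ⊢ <;> linarith
  have h1 := (hb (Fin.append yp z)).2
  have h2 := (hb (Fin.append (fun i => !yp i) z)).1
  rw [hg] at h1 h2
  simp_rw [hs] at h1
  simp_rw [hs', Finset.sum_neg_distrib] at h2
  linarith

/-- `Inf_{y_i}[q] = 4 E_z[g_i²]`. [cite: ODonnellZhao2016, eqn. (2.1)] -/
theorem influence_castAdd (i : Fin N) :
    influence (Fin.castAdd N i) q = 4 * boolAvg (fun z => g i z ^ 2) := by
  classical
  rw [show influence (Fin.castAdd N i) q =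
    (∑ x, (evalBool q x - evalBool q (flipBit (Fin.castAdd N i) x)) ^ 2) / (2 : ℝ) ^ (N + N) from rfl]
  unfold boolAvg
  rw [sum_cube_append]
  simp_rw [flipBit_castAdd_append, hg]
  have hdiff : ∀ y z : Fin N → Bool,
      c₀ + ∑ l, (if y l then (1 : ℝ) else -1) * g l z -
        (c₀ + ∑ l, (if flipBit i y l then (1 : ℝ) else -1) * g l z) =
      2 * (if y i then (1 : ℝ) else -1) * g i z := by
    intro y z
    rw [add_sub_add_left_eq_sub, ← Finset.sum_sub_distrib, Finset.sum_eq_single i]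
    · simp only [flipBit, Function.update_self]
      cases y i <;> simp <;> ring
    · intro l _ hl
      simp [flipBit, Function.update_of_ne hl]
    · intro h; exact absurd (Finset.mem_univ i) h
  simp_rw [hdiff]
  have hsq : ∀ y z : Fin N → Bool, (2 * (if y i then (1 : ℝ) else -1) * g i z) ^ 2 = 4 * g i z ^ 2 := by
    intro y z; cases y i <;> simp <;> ring
  simp_rw [hsq]
  rw [Finset.sum_const, Finset.card_univ, Fintype.card_fun, Fintype.card_bool, Fintype.card_fin, nsmul_eq_mul,
    ← Finset.mul_sum, pow_add]
  push_cast
  field_simp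

/-- `Inf_{z_j}[q] = Σ_i E_z[(g_i − g_i^{⊕j})²]`. [cite: ODonnellZhao2016, eqn. (2.1)] -/
theorem influence_natAdd (j : Fin N) :
    influence (Fin.natAdd N j) q = ∑ i, boolAvg (fun z => (g i z - g i (flipBit j z)) ^ 2) := by
  classical
  rw [show influence (Fin.natAdd N j) q =
    (∑ x, (evalBool q x - evalBool q (flipBit (Fin.natAdd N j) x)) ^ 2) / (2 : ℝ) ^ (N + N) from rfl]
  unfold boolAvg
  rw [sum_cube_append]
  simp_rw [flipBit_natAdd_append, hg]
  have hdiff : ∀ y z : Fin N → Bool,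
      c₀ + ∑ l, (if y l then (1 : ℝ) else -1) * g l z -
        (c₀ + ∑ l, (if y l then (1 : ℝ) else -1) * g l (flipBit j z)) =
      ∑ l, (if y l then (1 : ℝ) else -1) * (g l z - g l (flipBit j z)) := by
    intro y z
    rw [add_sub_add_left_eq_sub, ← Finset.sum_sub_distrib]
    exact Finset.sum_congr rfl fun l _ => by ring
  simp_rw [hdiff]
  rw [Finset.sum_comm]
  simp_rw [sum_sq_sum_ite]
  rw [← Finset.mul_sum, Finset.sum_comm, ← Finset.sum_div, pow_add]
  field_simp

/-- `E q = c₀`. [cite: ODonnellZhao2016, eqn. (2.1)] -/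
theorem boolAvg_decoupled : boolAvg (evalBool q) = c₀ := by
  unfold boolAvg
  rw [sum_cube_append]
  simp_rw [hg, Finset.sum_add_distrib, Finset.sum_const, Finset.card_univ, Fintype.card_fun, Fintype.card_bool,
    Fintype.card_fin, nsmul_eq_mul]
  have h0 : ∑ y : Fin N → Bool, ∑ z : Fin N → Bool, ∑ i, (if y i then (1 : ℝ) else -1) * g i z = 0 := by
    rw [Finset.sum_comm]
    refine Finset.sum_eq_zero fun z _ => ?_
    rw [Finset.sum_comm]
    refine Finset.sum_eq_zero fun i _ => ?_
    rw [← Finset.sum_mul, sum_ite_sign_eq_zero i, zero_mul]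
  rw [h0, add_zero, pow_add]
  push_cast
  field_simp

/-- `Var q = Σ_i E_z[g_i²]`. [cite: ODonnellZhao2016, eqn. (2.1)] -/
theorem boolVariance_decoupled : boolVariance q = ∑ i, boolAvg (fun z => g i z ^ 2) := by
  unfold boolVariance
  rw [boolAvg_decoupled hg]
  unfold boolAvg
  rw [sum_cube_append]
  simp_rw [hg, add_sub_cancel_left]
  rw [Finset.sum_comm]
  simp_rw [sum_sq_sum_ite]
  rw [← Finset.mul_sum, Finset.sum_comm, ← Finset.sum_div, pow_add]
  field_simp

/-- Each `g_i` is (the cube function of) a polynomial in the `z`-variables of total degree `≤ deg q`: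
`g_i = (q|_{y=e_i} − q|_{y=0})/2`. [cite: ODonnellZhao2016, Def. 1.1] -/
theorem exists_poly_eq {d : ℕ} (hdeg : q.totalDegree ≤ d) (i : Fin N) :
    ∃ r : MvPolynomial (Fin N) ℝ, r.totalDegree ≤ d ∧ ∀ z, evalBool r z = g i z := by
  classical
  -- substitution of constants `b ↦ y⁽ᵇ⁾` for the y-block, identity on the z-block
  let σ : Bool → Fin (N + N) → MvPolynomial (Fin N) ℝ := fun b =>
    Fin.addCases (fun i' : Fin N => MvPolynomial.C (if b ∧ i' = i then (1 : ℝ) else 0))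
      (fun j : Fin N => MvPolynomial.X j)
  have hσdeg : ∀ b v, (σ b v).totalDegree ≤ 1 := by
    intro b v
    refine Fin.addCases (fun i' => ?_) (fun j => ?_) v
    · simp only [σ, Fin.addCases_left, MvPolynomial.totalDegree_C]; exact Nat.zero_le _
    · simp only [σ, Fin.addCases_right, MvPolynomial.totalDegree_X]; exact le_refl _
  -- evaluating the substituted polynomial = evaluating `q` at the glued point
  have heval : ∀ (b : Bool) (z : Fin N → Bool),
      evalBool (MvPolynomial.bind₁ (σ b) q) z =
        evalBool q (Fin.append (fun i' => decide (b ∧ i' = i)) z) := by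
    intro b z
    unfold evalBool
    rw [show MvPolynomial.eval (fun k => if z k then (1 : ℝ) else 0) =
      MvPolynomial.eval₂Hom (RingHom.id ℝ) (fun k => if z k then (1 : ℝ) else 0) from rfl,
      MvPolynomial.eval₂Hom_bind₁]
    change _ = MvPolynomial.eval₂Hom (RingHom.id ℝ)
      (fun k => if Fin.append (fun i' => decide (b ∧ i' = i)) z k then (1 : ℝ) else 0) q
    have hF : (fun v => MvPolynomial.eval₂Hom (RingHom.id ℝ) (fun k => if z k then (1 : ℝ) else 0) (σ b v)) =
        (fun k => if Fin.append (fun i' => decide (b ∧ i' = i)) z k then (1 : ℝ) else 0) := by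
      funext v
      refine Fin.addCases (fun i' => ?_) (fun j => ?_) v
      · simp only [σ, Fin.addCases_left, Fin.append_left]
        rw [show MvPolynomial.eval₂Hom (RingHom.id ℝ) (fun k => if z k then (1 : ℝ) else 0) =
          MvPolynomial.eval (fun k => if z k then (1 : ℝ) else 0) from rfl, MvPolynomial.eval_C]
        by_cases h : (b ∧ i' = i) <;> simp [h]
      · simp only [σ, Fin.addCases_right, Fin.append_right]
        rw [show MvPolynomial.eval₂Hom (RingHom.id ℝ) (fun k => if z k then (1 : ℝ) else 0) =
          MvPolynomial.eval (fun k => if z k then (1 : ℝ) else 0) from rfl, MvPolynomial.eval_X]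
    rw [hF]
  refine ⟨MvPolynomial.C (1 / 2 : ℝ) * (MvPolynomial.bind₁ (σ true) q - MvPolynomial.bind₁ (σ false) q), ?_, ?_⟩
  · refine (MvPolynomial.totalDegree_mul _ _).trans ?_
    rw [MvPolynomial.totalDegree_C, zero_add]
    refine (MvPolynomial.totalDegree_sub _ _).trans (max_le ?_ ?_) <;>
      exact (totalDegree_bind₁_le_of_le_one _ (hσdeg _) q).trans hdeg
  · intro z
    have h1 := heval true z
    have h0 := heval false z
    unfold evalBool at h1 h0 ⊢
    rw [map_mul, MvPolynomial.eval_C, map_sub, h1, h0]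
    change 1 / 2 * (evalBool q _ - evalBool q _) = g i z
    rw [hg, hg, add_sub_add_left_eq_sub, ← Finset.sum_sub_distrib, Finset.sum_eq_single i]
    · simp; ring
    · intro l _ hl
      simp [hl]
    · intro h; exact absurd (Finset.mem_univ i) h

end StubDerivativeFamily

open StubDerivativeFamily in
/-- **Stub `stub_derivativeFamily` of line `l1-family`** (registered signature, BY NAME): the bookkeeping of a
one-block-decoupled bounded polynomial — `ℓ¹`-boundedness `Σ_i |g_i(z)| ≤ 1/2`, the influence and variance
formulas, and the realisation of each `g_i` as a polynomial of total degree `≤ d`. [cite: ODonnellZhao2016, eqn. (2.1)] -/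
theorem stub_derivativeFamily :
    ∀ (N d : ℕ) (q : MvPolynomial (Fin (N + N)) ℝ) (c₀ : ℝ) (g : Fin N → (Fin N → Bool) → ℝ),
      (∀ (y z : Fin N → Bool),
          evalBool q (Fin.append y z) = c₀ + ∑ i, (if y i then (1 : ℝ) else -1) * g i z) →
      q.totalDegree ≤ d → (∀ x, 0 ≤ evalBool q x ∧ evalBool q x ≤ 1) →
      (∀ z, ∑ i, |g i z| ≤ 1 / 2) ∧
      (∀ i, influence (Fin.castAdd N i) q = 4 * boolAvg (fun z => g i z ^ 2)) ∧
      (∀ j, influence (Fin.natAdd N j) q = ∑ i, boolAvg (fun z => (g i z - g i (flipBit j z)) ^ 2)) ∧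
      boolVariance q = ∑ i, boolAvg (fun z => g i z ^ 2) ∧
      (∀ i, ∃ r : MvPolynomial (Fin N) ℝ, r.totalDegree ≤ d ∧ ∀ z, evalBool r z = g i z) := by
  intro N d q c₀ g hg hdeg hb
  exact ⟨sum_abs_le_half hg hb, influence_castAdd hg, influence_natAdd hg, boolVariance_decoupled hg,
    exists_poly_eq hg hdeg⟩

end Summit.QuantumAdvantage.QuantumAdvantage.Cruxes.DecoupledCoreAA.L1Family

end
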